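import Mathlib
import Literature.Probability.Percolation.Percolation
import HarnessLib

/-!
# `NoHeavyLowerTail` (stmt-CriticalPhenomena-4575) — pattern cells: the law of the connection pattern of five terminals

Support file (depth prover nh-dp-blobmono gen 2; `--supports stmt-CriticalPhenomena-4575`).  Three bookkeeping
definitions (`pairFst`/`pairSnd`, `Cell`, `Cons5`), no named facts, no sorries.

PURPOSE.  The certificate searches of the one-cut / CIL line (prim-cplus-engine, prim-nh-lead-4575, this unit) produce
Positivstellensatz certificates: identities among products of probabilities of CONNECTION EVENTS of five terminals
`v 0, …, v 4` (unions of cells of the partition lattice, 52 cells), valid coefficientwise.  To turn such a certificate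
into a Lean proof one needs every event probability written as a sum of CELL probabilities.  This file provides the
bookkeeping once and for all, indexing cells by connection PATTERNS `m < 2^10` (one bit per pair of terminals):

* `Cell v m = {ω | ∀ p < 10, (v p₁ ↔ v p₂ in ω) ↔ testBit m p}`;
* `exists_mem_cell` — every configuration lies in some cell `m < 1024` (bits exist);
* `cell_disjoint` — distinct patterns give disjoint cells;
* `consistent_of_mem_cell` — a nonempty cell has a TRANSITIVELY CONSISTENT pattern (the Boolean test `Cons5`, 30
  implications), so inconsistent patterns carry no mass (of the 1024 patterns exactly 52 are consistent);
* `measureReal_eq_sum_cells` — for an event `E` READ OFF the pattern (`ω ∈ Cell m → (ω ∈ E ↔ φ m)`),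
  `μ(E) = Σ_{m < 1024, Cons5 m ∧ φ m} μ(Cell m)` for every finite measure; the index Finset is then evaluated by
  `decide` in applications (tested: < 3 s with `maxRecDepth 100000`).

Pairs are numbered `p = 0..9 ↦ (0,1),(0,2),(0,3),(0,4),(1,2),(1,3),(1,4),(2,3),(2,4),(3,4)`.
-/

noncomputable section

namespace Summit.CriticalPhenomena.PercolationContinuityZ3.Theorems

open MeasureTheory Set Literature.Probability.Percolation
open scoped Classical BigOperators

namespace PatternCells

variable {n : ℕ}

/-- First terminal of pair number `p`: pairs `(0,1),(0,2),(0,3),(0,4),(1,2),(1,3),(1,4),(2,3),(2,4),(3,4)`. [folklore] -/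
def pairFst : Fin 10 → Fin 5 := ![0, 0, 0, 0, 1, 1, 1, 2, 2, 3]

/-- Second terminal of pair number `p`. [folklore] -/
def pairSnd : Fin 10 → Fin 5 := ![1, 2, 3, 4, 2, 3, 4, 3, 4, 4]

/-- The cell of pattern `m` for terminals `v`: the connected pairs of terminals are exactly the bits of `m`. [folklore] -/
def Cell (v : Fin 5 → Fin n) (m : ℕ) : Set (BondConfig (Fin n)) :=
  {ω | ∀ p : Fin 10, (openGraph ω).Reachable (v (pairFst p)) (v (pairSnd p)) ↔ Nat.testBit m p.val = true}

/-- Transitive consistency of a pattern (Boolean, for `decide`): for each of the ten triangles of terminals, two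
connections force the third.  Triangles as triples of pair numbers `(ij, ik, jk)`. [folklore] -/
def Cons5 (m : ℕ) : Bool :=
  List.all [(0,1,4), (0,2,5), (0,3,6), (1,2,7), (1,3,8), (2,3,9), (4,5,7), (4,6,8), (5,6,9), (7,8,9)]
    fun t : ℕ × ℕ × ℕ =>
      (!(Nat.testBit m t.1 && Nat.testBit m t.2.1) || Nat.testBit m t.2.2) &&
      (!(Nat.testBit m t.1 && Nat.testBit m t.2.2) || Nat.testBit m t.2.1) &&
      (!(Nat.testBit m t.2.1 && Nat.testBit m t.2.2) || Nat.testBit m t.1)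

/-- Natural numbers with prescribed low bits exist. [folklore] -/
theorem exists_testBit_eq (f : ℕ → Bool) : ∀ k : ℕ, ∃ m : ℕ, m < 2 ^ k ∧ ∀ i < k, Nat.testBit m i = f i := by
  intro k
  induction k generalizing f with
  | zero => exact ⟨0, by norm_num, fun i hi => absurd hi (Nat.not_lt_zero i)⟩
  | succ k ih =>
    obtain ⟨m', hm', hbits⟩ := ih (fun i => f (i + 1))
    refine ⟨Nat.bit (f 0) m', Nat.bit_lt_two_pow_succ_iff.2 hm', fun i hi => ?_⟩
    cases i with
    | zero => exact Nat.testBit_bit_zero _ _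
    | succ i => rw [Nat.testBit_bit_succ]; exact hbits i (by omega)

/-- **Cover.** Every configuration lies in the cell of some pattern `m < 1024`. [folklore] -/
theorem exists_mem_cell (v : Fin 5 → Fin n) (ω : BondConfig (Fin n)) : ∃ m : ℕ, m < 1024 ∧ ω ∈ Cell v m := by
  obtain ⟨m, hm, hbits⟩ := exists_testBit_eq
    (fun i => if h : i < 10 then decide ((openGraph ω).Reachable (v (pairFst ⟨i, h⟩)) (v (pairSnd ⟨i, h⟩))) else false) 10
  refine ⟨m, by simpa using hm, fun p => ?_⟩
  rw [hbits p.val p.isLt, dif_pos p.isLt]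
  simp only [Fin.eta, decide_eq_true_eq]

/-- **Disjointness.** Distinct patterns below `1024` have disjoint cells. [folklore] -/
theorem cell_disjoint (v : Fin 5 → Fin n) {m m' : ℕ} (hm : m < 1024) (hm' : m' < 1024) (hne : m ≠ m') :
    Disjoint (Cell v m) (Cell v m') := by
  rw [Set.disjoint_left]
  intro ω h1 h2
  apply hne
  apply Nat.eq_of_testBit_eq
  intro i
  by_cases hi : i < 10
  · have e1 := h1 ⟨i, hi⟩
    have e2 := h2 ⟨i, hi⟩
    simp only at e1 e2
    rcases Bool.eq_false_or_eq_true (Nat.testBit m i) with h | h <;>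
      rcases Bool.eq_false_or_eq_true (Nat.testBit m' i) with h' | h' <;> simp_all
  · have h10 : 2 ^ 10 ≤ 2 ^ i := Nat.pow_le_pow_right (by norm_num) (by omega)
    rw [Nat.testBit_eq_false_of_lt (lt_of_lt_of_le (by simpa using hm) h10),
      Nat.testBit_eq_false_of_lt (lt_of_lt_of_le (by simpa using hm') h10)]

/-- Boolean form of "two sides of a triangle force the third". [folklore] -/
theorem tri_bool {x y z : Bool} {A B C : Prop} (hx : x = true ↔ A) (hy : y = true ↔ B) (hz : z = true ↔ C)
    (h1 : A → B → C) (h2 : A → C → B) (h3 : B → C → A) :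
    ((!(x && y) || z) && (!(x && z) || y) && (!(y && z) || x)) = true := by
  cases x <;> cases y <;> cases z <;> simp_all

/-- **Consistency.** A nonempty cell has a transitively consistent pattern. [folklore] -/
theorem consistent_of_mem_cell (v : Fin 5 → Fin n) {m : ℕ} {ω : BondConfig (Fin n)} (hω : ω ∈ Cell v m) :
    Cons5 m = true := by
  have R : ∀ p : Fin 10, Nat.testBit m p.val = true ↔ (openGraph ω).Reachable (v (pairFst p)) (v (pairSnd p)) :=
    fun p => (hω p).symm
  -- triangle (i,j,k) with pair numbers (ij, ik, jk): the three transitivity implications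
  have T : ∀ (pij pik pjk : ℕ) (hij : pij < 10) (hik : pik < 10) (hjk : pjk < 10) (i j k : Fin 5),
      pairFst ⟨pij, hij⟩ = i → pairSnd ⟨pij, hij⟩ = j → pairFst ⟨pik, hik⟩ = i → pairSnd ⟨pik, hik⟩ = k →
      pairFst ⟨pjk, hjk⟩ = j → pairSnd ⟨pjk, hjk⟩ = k →
      ((!(Nat.testBit m pij && Nat.testBit m pik) || Nat.testBit m pjk) &&
       (!(Nat.testBit m pij && Nat.testBit m pjk) || Nat.testBit m pik) &&
       (!(Nat.testBit m pik && Nat.testBit m pjk) || Nat.testBit m pij)) = true := by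
    intro pij pik pjk hij hik hjk i j k h1 h2 h3 h4 h5 h6
    have Rij := R ⟨pij, hij⟩; have Rik := R ⟨pik, hik⟩; have Rjk := R ⟨pjk, hjk⟩
    rw [h1, h2] at Rij; rw [h3, h4] at Rik; rw [h5, h6] at Rjk
    exact tri_bool Rij Rik Rjk (fun a b => a.symm.trans b) (fun a c => a.trans c) (fun b c => b.trans c.symm)
  have t0 := T 0 1 4 (by norm_num) (by norm_num) (by norm_num) 0 1 2 rfl rfl rfl rfl rfl rfl
  have t1 := T 0 2 5 (by norm_num) (by norm_num) (by norm_num) 0 1 3 rfl rfl rfl rfl rfl rfl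
  have t2 := T 0 3 6 (by norm_num) (by norm_num) (by norm_num) 0 1 4 rfl rfl rfl rfl rfl rfl
  have t3 := T 1 2 7 (by norm_num) (by norm_num) (by norm_num) 0 2 3 rfl rfl rfl rfl rfl rfl
  have t4 := T 1 3 8 (by norm_num) (by norm_num) (by norm_num) 0 2 4 rfl rfl rfl rfl rfl rfl
  have t5 := T 2 3 9 (by norm_num) (by norm_num) (by norm_num) 0 3 4 rfl rfl rfl rfl rfl rfl
  have t6 := T 4 5 7 (by norm_num) (by norm_num) (by norm_num) 1 2 3 rfl rfl rfl rfl rfl rfl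
  have t7 := T 4 6 8 (by norm_num) (by norm_num) (by norm_num) 1 2 4 rfl rfl rfl rfl rfl rfl
  have t8 := T 5 6 9 (by norm_num) (by norm_num) (by norm_num) 1 3 4 rfl rfl rfl rfl rfl rfl
  have t9 := T 7 8 9 (by norm_num) (by norm_num) (by norm_num) 2 3 4 rfl rfl rfl rfl rfl rfl
  simp only [Cons5, List.all_cons, List.all_nil, t0, t1, t2, t3, t4, t5, t6, t7, t8, t9, Bool.and_self]

/-- **Cell expansion of an event read off the pattern.**  If membership in `E` is decided by the pattern
(`ω ∈ Cell m → (ω ∈ E ↔ φ m)` for `m < 1024`), then for every finite measure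
`μ(E) = Σ_{m < 1024, consistent, φ m} μ(Cell m)`. [folklore] -/
theorem measureReal_eq_sum_cells (μ : Measure (BondConfig (Fin n))) [IsFiniteMeasure μ] (v : Fin 5 → Fin n)
    (E : Set (BondConfig (Fin n))) (φ : ℕ → Bool)
    (hE : ∀ m < 1024, ∀ ω ∈ Cell v m, (ω ∈ E ↔ φ m = true)) :
    μ.real E = ∑ m ∈ (Finset.range 1024).filter (fun m => Cons5 m = true ∧ φ m = true), μ.real (Cell v m) := by
  set S := (Finset.range 1024).filter (fun m => Cons5 m = true ∧ φ m = true) with hS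
  have hEeq : E = ⋃ m ∈ S, Cell v m := by
    ext ω
    constructor
    · intro hω
      obtain ⟨m, hm, hcell⟩ := exists_mem_cell v ω
      refine Set.mem_iUnion₂.2 ⟨m, ?_, hcell⟩
      rw [hS, Finset.mem_filter, Finset.mem_range]
      exact ⟨hm, consistent_of_mem_cell v hcell, (hE m hm ω hcell).1 hω⟩
    · intro hω
      obtain ⟨m, hm, hcell⟩ := Set.mem_iUnion₂.1 hω
      rw [hS, Finset.mem_filter, Finset.mem_range] at hm
      exact (hE m hm.1 ω hcell).2 hm.2.2
  rw [hEeq]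
  refine measureReal_biUnion_finset (fun m hm m' hm' hne => ?_) (fun m _ => MeasurableSet.of_discrete)
  have hm1 := (Finset.mem_filter.1 (Finset.mem_coe.1 hm)).1
  have hm2 := (Finset.mem_filter.1 (Finset.mem_coe.1 hm')).1
  rw [Finset.mem_range] at hm1 hm2
  exact cell_disjoint v hm1 hm2 hne

/-- **Pattern bits decide literals**: inside `Cell m`, `v i ↔ v j` holds iff the bit of the pair is set
(stated for each pair number `p`). [folklore] -/
theorem reachable_iff_of_mem_cell (v : Fin 5 → Fin n) {m : ℕ} {ω : BondConfig (Fin n)} (hω : ω ∈ Cell v m)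
    (p : Fin 10) : (openGraph ω).Reachable (v (pairFst p)) (v (pairSnd p)) ↔ Nat.testBit m p.val = true := hω p

/-- **Example / template.** The connection event of pair `p` expands over the cells whose pattern has bit `p`. [folklore] -/
theorem measureReal_reachable_eq_sum_cells (μ : Measure (BondConfig (Fin n))) [IsFiniteMeasure μ]
    (v : Fin 5 → Fin n) (p : Fin 10) :
    μ.real {ω | (openGraph ω).Reachable (v (pairFst p)) (v (pairSnd p))} =
      ∑ m ∈ (Finset.range 1024).filter (fun m => Cons5 m = true ∧ Nat.testBit m p.val = true),
        μ.real (Cell v m) :=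
  measureReal_eq_sum_cells μ v _ (fun m => Nat.testBit m p.val) fun _ _ _ hω => hω p

set_option maxRecDepth 100000 in
/-- Exactly `52 = Bell(5)` of the `1024` patterns are consistent (the index sets of the expansions are evaluated
by `decide` in the same way). [folklore] -/
theorem card_consistent_patterns : ((Finset.range 1024).filter fun m => Cons5 m = true).card = 52 := by
  decide


end PatternCells

end Summit.CriticalPhenomena.PercolationContinuityZ3.Theorems

end
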